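import Literature.MathematicalPhysics.QuantumLattice.MPSCoarseGrainingMaps
import HarnessLib

/-!
# Nested window marginals: local translation invariance descends to every sub-window

The marginal problem behind the MPS relaxation (Kull–Schuch–Dive–Navascués, arXiv:2212.03014, §2.1–2.3) works with the
chain `ρ_2, ρ_3, …, ρ_N` of reduced density matrices of the first `m` sites of ONE translation-invariant state, tied together
by `tr_L ρ_m = ρ_{m−1} = tr_R ρ_m` (eq. (locTIn)). A finite certificate (`lti(N)`, `mps(n,D,A)`) only ever sees the LARGEST
window `ρ_N` with its single LTI row `tr_L ρ_N = tr_R ρ_N`; this file proves that the whole nested chain is then recovered by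
partial traces: with `headMarginal h ρ := tr_{sites ≥ m} ρ` (the marginal on the first `m` sites, `m ≤ N`),
`tr_R (headMarginal ρ) = headMarginal ρ` one size down (always) and `tr_L (headMarginal ρ) = tr_R (headMarginal ρ)` (from the
LTI row of `ρ`). Together with `MPSCoarseGrainingMaps` (`traceLeft_cgState_succ`, …) this turns one LTI window variable into a
feasible point of the coarse-grained relaxation. No `sorry`, no new axiom, no named fact.
[cite: KullEtAl2024, §2.1 eq. (locTIn), §2.3]
-/

noncomputable section

namespace Literature.MathematicalPhysics.QuantumLattice

open Matrix
open scoped ComplexOrder BigOperators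

section NestedMarginals

variable {q : ℕ}

/-- **The marginal on the first `m` sites** of an `N`-site window variable (`m ≤ N`): the partial trace over the sites
`m, …, N−1`. [cite: KullEtAl2024, §2.1 (the reduced states `ρ_m` of the first `m` sites)] -/
def headMarginal {N m : ℕ} (h : m ≤ N) (ρ : Op (Fin N) q) : Op (Fin m) q :=
  spinPartialTrace (Fin.castLEEmb h) ρ

/-- `headMarginal` at full size is the identity. [cite: KullEtAl2024, §2.1] -/
theorem headMarginal_self {N : ℕ} (ρ : Op (Fin N) q) : headMarginal le_rfl ρ = ρ := by
  rw [headMarginal, show Fin.castLEEmb (le_rfl : N ≤ N) = Function.Embedding.refl (Fin N) from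
    Function.Embedding.ext fun i => Fin.ext rfl, spinPartialTrace_refl]

/-- Head marginals of states are states. [cite: KullEtAl2024, §2.1] -/
theorem posSemidef_headMarginal {N m : ℕ} (h : m ≤ N) {ρ : Op (Fin N) q} (hρ : ρ.PosSemidef) :
    (headMarginal h ρ).PosSemidef :=
  posSemidef_spinPartialTrace _ hρ

/-- Head marginals preserve the trace. [cite: KullEtAl2024, §2.1] -/
theorem trace_headMarginal {N m : ℕ} (h : m ≤ N) (ρ : Op (Fin N) q) : (headMarginal h ρ).trace = ρ.trace :=
  trace_spinPartialTrace _ ρ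

/-- `castSucc ≫ castLE = castLE`. [cite: KullEtAl2024, §2.1] -/
theorem castSuccEmb_trans_castLEEmb {N m : ℕ} (h : m + 1 ≤ N) :
    Fin.castSuccEmb.trans (Fin.castLEEmb h) = Fin.castLEEmb ((Nat.le_succ m).trans h) :=
  Function.Embedding.ext fun _ => Fin.ext rfl

/-- `castLE ≫ castSucc = castLE`. [cite: KullEtAl2024, §2.1] -/
theorem castLEEmb_trans_castSuccEmb {M m : ℕ} (h : m ≤ M) :
    (Fin.castLEEmb h).trans Fin.castSuccEmb = Fin.castLEEmb (h.trans (Nat.le_succ M)) :=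
  Function.Embedding.ext fun _ => Fin.ext rfl

/-- `succ ≫ castLE = castLE ≫ succ` (the shifted sub-window of a head window is a head window of the shifted window).
[cite: KullEtAl2024, §2.1] -/
theorem succEmb_trans_castLEEmb {M m : ℕ} (h : m ≤ M) :
    (Fin.succEmb m).trans (Fin.castLEEmb (Nat.succ_le_succ h)) = (Fin.castLEEmb h).trans (Fin.succEmb M) :=
  Function.Embedding.ext fun i => Fin.ext (by simp [Fin.castLEEmb, Fin.val_succ])

/-- **`tr_R` of a head marginal is the next head marginal**: `tr_{last} (ρ|_{first m+1}) = ρ|_{first m}`.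
[cite: KullEtAl2024, §2.1 eq. (locTIn)] -/
theorem spinPartialTrace_castSuccEmb_headMarginal {N m : ℕ} (h : m + 1 ≤ N) (ρ : Op (Fin N) q) :
    spinPartialTrace Fin.castSuccEmb (headMarginal h ρ) = headMarginal ((Nat.le_succ m).trans h) ρ := by
  rw [headMarginal, headMarginal, ← spinPartialTrace_trans, castSuccEmb_trans_castLEEmb]

/-- **LTI descends**: if the `M+1`-site window variable satisfies `tr_L ρ = tr_R ρ`, then every head marginal satisfies
`tr_L (ρ|_{first m+1}) = tr_R (ρ|_{first m+1})` (`= ρ|_{first m}`). [cite: KullEtAl2024, §2.1 eq. (locTIn)] -/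
theorem lti_headMarginal {M m : ℕ} {ρ : Op (Fin (M + 1)) q}
    (hLTI : spinPartialTrace (Fin.succEmb M) ρ = spinPartialTrace Fin.castSuccEmb ρ) (h : m ≤ M) :
    spinPartialTrace (Fin.succEmb m) (headMarginal (Nat.succ_le_succ h) ρ) =
      spinPartialTrace Fin.castSuccEmb (headMarginal (Nat.succ_le_succ h) ρ) := by
  rw [headMarginal, ← spinPartialTrace_trans, ← spinPartialTrace_trans, succEmb_trans_castLEEmb h, spinPartialTrace_trans, hLTI,
    ← spinPartialTrace_trans, castLEEmb_trans_castSuccEmb, castSuccEmb_trans_castLEEmb]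

/-- The `tr_L` form: `tr_{first} (ρ|_{first m+1}) = ρ|_{first m}` under the LTI row. [cite: KullEtAl2024, §2.1 eq. (locTIn)] -/
theorem spinPartialTrace_succEmb_headMarginal {M m : ℕ} {ρ : Op (Fin (M + 1)) q}
    (hLTI : spinPartialTrace (Fin.succEmb M) ρ = spinPartialTrace Fin.castSuccEmb ρ) (h : m ≤ M) :
    spinPartialTrace (Fin.succEmb m) (headMarginal (Nat.succ_le_succ h) ρ) = headMarginal (h.trans (Nat.le_succ M)) ρ := by
  rw [lti_headMarginal hLTI h, spinPartialTrace_castSuccEmb_headMarginal]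

end NestedMarginals

/-! ### The coarse-grained chain `ω_{k+2} = C_k(ρ|_{first k+2})` of one LTI window variable satisfies the extension rows -/

namespace MPSCoarseGraining

open Literature.Computability.QuantumComplexity
open scoped Kronecker

variable {β : Type*} [Fintype β] [DecidableEq β] {q : ℕ}

/-- **Row `EmL` on one LTI window variable**: for `ρ` on `M+1 ≥ k+3` sites with `tr_L ρ = tr_R ρ`, the coarse-grained head
marginals `ω_{k+3} = C_{k+1}(ρ|_{k+3})`, `ω_{k+2} = C_k(ρ|_{k+2})` satisfy
`tr_{s_L} ω_{k+3} = (L ⊗ 𝟙) ω_{k+2} (L ⊗ 𝟙)ᴴ` — KSDN eq. (TNoneStepRelaxation), first row, at the TRUE marginals.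
[cite: KullEtAl2024, §2.3 eq. (TNoneStepRelaxation), §4.2] -/
theorem traceLeft_cgState_headMarginal (A : Fin q → Matrix β β ℂ) (k : ℕ) {M : ℕ} {ρ : Op (Fin (M + 1)) q}
    (hLTI : spinPartialTrace (Fin.succEmb M) ρ = spinPartialTrace Fin.castSuccEmb ρ) (h : k + 2 ≤ M) :
    traceLeft (cgState A (k + 1) (headMarginal (Nat.succ_le_succ h) ρ)) =
      (leftMap A ⊗ₖ (1 : Matrix (Fin q) (Fin q) ℂ)) *
          (cgState A k (headMarginal (h.trans (Nat.le_succ M)) ρ)).submatrix (Equiv.prodAssoc _ _ _) (Equiv.prodAssoc _ _ _) *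
        (leftMap A ⊗ₖ (1 : Matrix (Fin q) (Fin q) ℂ))ᴴ := by
  rw [traceLeft_cgState_succ, spinPartialTrace_succEmb_headMarginal hLTI h]

/-- **Row `EmR` on one LTI window variable**: `tr_{s_R} ω_{k+3} = (𝟙 ⊗ R) ω_{k+2} (𝟙 ⊗ R)ᴴ` (reassociated), second row of
KSDN eq. (TNoneStepRelaxation) at the TRUE marginals (no LTI needed: `tr_R` of a head marginal is the next head marginal).
[cite: KullEtAl2024, §2.3 eq. (TNoneStepRelaxation), §4.2] -/
theorem traceRight_cgState_headMarginal (A : Fin q → Matrix β β ℂ) (k : ℕ) {M : ℕ} (ρ : Op (Fin (M + 1)) q) (h : k + 2 ≤ M) :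
    traceRight ((cgState A (k + 1) (headMarginal (Nat.succ_le_succ h) ρ)).submatrix (Equiv.prodAssoc _ _ _) (Equiv.prodAssoc _ _ _)) =
      ((1 : Matrix (Fin q) (Fin q) ℂ) ⊗ₖ rightMap A) * cgState A k (headMarginal (h.trans (Nat.le_succ M)) ρ) *
        ((1 : Matrix (Fin q) (Fin q) ℂ) ⊗ₖ rightMap A)ᴴ := by
  rw [traceRight_cgState_succ_submatrix_prodAssoc, spinPartialTrace_castSuccEmb_headMarginal]

end MPSCoarseGraining

end Literature.MathematicalPhysics.QuantumLattice
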